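import Literature.AnabelianGeometry.EtaleTheta.KummerTwistNorm
import Literature.IUT.HodgeTheaters.GlobalFrobenioidsCoricRigidityGenuineKummer
import Literature.IUT.HodgeTheaters.GlobalFrobenioidsCoricRigidityOfSubset
import HarnessLib

/-!
# [IUTchI] Example 5.1 (v), pp. 127–128: law (b′) from the ADDITIVITY OF THE ORDER on fixed rational functions
# alone; the ∞κ- and ∞κ×-uniqueness at the genuine Kummer map with no container-level and no inertia law
# (proof-only)

S. Mochizuki, *Inter-universal Teichmüller theory I*, kurims manuscript (May 2020), §5 Example 5.1 (v), p. 127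
l. 76 – p. 128 l. 2 ([IUTchI] Ex 5.1 (v) p.127) [claim: Mochizuki2012, status: disputed]: "by considering divisors of
zeroes and poles [cf. the definition of a '`κ`-coric function' given in Remark 3.1.7, (i)] associated to Kummer
classes of rational functions as in [AbsTopIII], Proposition 1.6, (iii), from the elementary observation that …
`ℚ_{>0} ∩ Ẑ^× = {1}`"; p. 128 l. 49–54 "`†ℱ^⊛` always admits an ∞κ-coric (respectively, ∞κ×-coric) structure, which
is, moreover, unique up to a uniquely determined isomorphism".  [AbsTopIII] Prop. 1.6 (iii) p. 36
[MochizukiAbsTopIII2015]; LANA §6.1 pp. 31–32 [LANA2026Report].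

Sub-DAG `plan/L5/SUBDAG-IUTchI-Ex51.md` rows E51/L27 (b′) ⇒ E51/L29 (both halves); GAP-LEDGER G-w4d056-2; node
IUTchI:Ex5.1(v).  PROOF-ONLY: theorems, no definition, no instance, no new `Prop` fact.

**State before this file.**  abc-iut-w4-d056's `GlobalFrobenioidsCoricRigidityOfInertia` / `…OfSubset` (p433954 /
p433935) turn law (b′) `hord` into a theorem of INERTIA data (i)–(iii) at the points.  abc-iut-w4-d057's NORM
route (`KummerContainerValuationTransport.lean`, p433474, at the arithmetic instance) and its abstract form
`apply_eta_eq_eta_of_kummerMap_eq_H1ColimTwist_of_fixed` (abc-iut-w4-d056, `KummerTwistNorm.lean`: the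
coset-product norm over a finite-index normal level) need NO inertia: for `π₁^rat`-FIXED `f, f′` the relation
`κ(f′) = u · κ(f)` forces `u(η(φ f)) = η(φ f′)` for EVERY `φ` additive on products of fixed elements.

**What this file proves.**  `NFBridgeRecon.kummerMap_hord_of_ordHom_of_subset`: law (b′) at the genuine Kummer
map of ANY `π₁^rat`-stable pseudo-monoid `M ⊆ K_rat` (`0 ∉ M`) from the single law
  (o) `ord_x(a·b) = ord_x(a) + ord_x(b)` for `π₁^rat`-FIXED nonzero rational functions `a, b` [the order at a point
      `x` is a valuation of the function field `L_C = K_rat^{π₁^rat}`]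
and the finite index of the levels.  Hence **`existsUniqueCoricStructure_infκPair_of_ordHom`** /
**`…_infκxPair_of_ordHom`** (and the `…_of_fixedRoots` variants): the boxed uniqueness for BOTH pairs at the
GENUINE Kummer map with hypotheses: structural side conditions (`hcoe`; `S` directed exhaustive system of normal
finite-index subgroups; `K_rat^×` rootable with all roots of unity; `1 ∈ M`, `f ∈ M ⇔ fⁿ ∈ M`), injectivity of the
Kummer map (E51/L26) or (iv) no divisible invariants, (o), and Rmk 3.1.7 (i)/(ii) `hpole`/`hex` — no Kummer
container / realisation / `Ẑ^×`-element / law (a) / law (b′) / inertia datum.  No side is taken on [IUTchIII]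
Cor. 3.12; nothing of the disputed series is asserted; typed ≠ proved.
-/

namespace Literature.IUT.HodgeTheaters

open ProfiniteGrp ProfiniteGrp.ProfiniteCompletion
open Literature.AnabelianGeometry.EtaleTheta Literature.AnabelianGeometry.EtaleTheta.ZHatLevel

namespace NFBridgeRecon

variable (N : NFBridgeRecon.{0}) (M : Set N.Krat) (hM : ∀ (g : N.piRat) {f : N.Krat}, f ∈ M → g • f ∈ M)
  [MulDistribMulAction N.piRat N.Kratˣ] {ι : Type} [Preorder ι] [DecidableEq ι] [IsDirectedOrder ι]
  (S : ι → Subgroup N.piRat) (hS : ∀ ⦃i j : ι⦄, i ≤ j → S j ≤ S i) [hN : ∀ i, (S i).Normal] [RootableBy N.Kratˣ ℕ]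

/-- **LAW (b′) at the pair `π₁^rat ↷ M` from the ADDITIVITY OF `ord_x` on `π₁^rat`-fixed nonzero rational functions**
(and the finite index of the levels): whenever `κ(f′) = u · κ(f)` at the genuine Kummer map for `π₁^rat`-fixed
`f, f′ ∈ M` and `u ∈ Ẑ^× = Aut(Ẑ)`, then `u(η(ord_x f)) = η(ord_x f′)` at every point `x`.  PROVED (engine:
`apply_eta_eq_eta_of_kummerMap_eq_H1ColimTwist_of_fixed` — abc-iut-w4-d057's level step + the coset-product norm).
([IUTchI] Ex 5.1 (v) p.127) [claim: Mochizuki2012, status: disputed] -/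
theorem kummerMap_hord_of_ordHom_of_subset (h0 : (0 : N.Krat) ∉ M)
    (hcoe : ∀ (g : N.piRat) (a : N.Kratˣ), ((g • a : N.Kratˣ) : N.Krat) = g • (a : N.Krat))
    (hc : IsExhausted N.Kratˣ S) (hfi : ∀ i, (S i).FiniteIndex) {X : Type*} (ord : X → N.Krat → ℤ)
    (hordmul : ∀ (x : X) (a b : N.Krat), a ≠ 0 → b ≠ 0 → (∀ g : N.piRat, g • a = a) → (∀ g : N.piRat, g • b = b) →
      ord x (a * b) = ord x a + ord x b)
    (u : MulAut (completion (GrpCat.of (Multiplicative ℤ)))) (f f' : (N.coricPairOfSubset M hM).carrier)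
    (hf : ∀ g : N.piRat, g • (f : N.Krat) = f) (hf' : ∀ g : N.piRat, g • (f' : N.Krat) = f')
    (h : kummerMap hS hc (Units.mk0 (f' : N.Krat) (N.coe_ne_zero_of_subset M hM h0 f')) =
      H1ColimTwist S hS u (kummerMap hS hc (Units.mk0 (f : N.Krat) (N.coe_ne_zero_of_subset M hM h0 f))))
    (x : X) : u (eta (ord x f)) = eta (ord x f') := by
  have hfix : ∀ {φ : N.Krat} (hφ0 : φ ≠ 0), (∀ g : N.piRat, g • φ = φ) →
      ∀ g : N.piRat, g • Units.mk0 φ hφ0 = Units.mk0 φ hφ0 := fun hφ0 hφ g =>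
    Units.ext (by rw [hcoe, Units.val_mk0, hφ g])
  have key := apply_eta_eq_eta_of_kummerMap_eq_H1ColimTwist_of_fixed S hS hc hfi
    (hfix (N.coe_ne_zero_of_subset M hM h0 f) hf) (hfix (N.coe_ne_zero_of_subset M hM h0 f') hf') u h
    (fun a : N.Kratˣ => ord x (a : N.Krat)) (fun a b ha hb => by
      have ha' : ∀ g : N.piRat, g • (a : N.Krat) = a := fun g => by rw [← hcoe, ha g]
      have hb' : ∀ g : N.piRat, g • (b : N.Krat) = b := fun g => by rw [← hcoe, hb g]
      change ord x (((a * b : N.Kratˣ) : N.Krat)) = ord x (a : N.Krat) + ord x (b : N.Krat)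
      rw [Units.val_mul]
      exact hordmul x _ _ a.ne_zero b.ne_zero ha' hb')
  simpa only [Units.val_mk0] using key

variable [Nonempty ι]

/-- **[IUTchI] Ex. 5.1 (v), ∞κ: `ExistsUniqueCoricStructure π₁^rat 𝕄^⊛_∞κ(†𝒟^⊚)` at the GENUINE Kummer map with
(b′) from the additivity of `ord_x` on fixed rational functions (o)** — hypotheses: structural (incl. finite index
of the levels), injectivity of the Kummer map (E51/L26), (o), Rmk 3.1.7 (i)/(ii) `hpole`/`hex`.  PROVED.
([IUTchI] Ex 5.1 (v) p.128) [claim: Mochizuki2012, status: disputed] -/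
theorem existsUniqueCoricStructure_infκPair_of_ordHom
    (hcoe : ∀ (g : N.piRat) (a : N.Kratˣ), ((g • a : N.Kratˣ) : N.Krat) = g • (a : N.Krat))
    (hprim : ∀ n : ℕ, 0 < n → ∃ ζ : N.Krat, IsPrimitiveRoot ζ n) (hc : IsExhausted N.Kratˣ S)
    (hfi : ∀ i, (S i).FiniteIndex)
    (h1 : (1 : N.Krat) ∈ N.Minfκ) (hpow : ∀ (f : N.Krat) (n : ℕ), 0 < n → (f ∈ N.Minfκ ↔ f ^ n ∈ N.Minfκ))
    (hinj : Function.Injective (kummerMap hS hc))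
    {X : Type*} (ord : X → N.Krat → ℤ)
    (hordmul : ∀ (x : X) (a b : N.Krat), a ≠ 0 → b ≠ 0 → (∀ g : N.piRat, g • a = a) → (∀ g : N.piRat, g • b = b) →
      ord x (a * b) = ord x a + ord x b)
    (hpole : ∀ f' ∈ N.Minfκ, (∀ g : N.piRat, g • f' = f') →
      ∀ x₁ x₂ : X, x₁ ≠ x₂ → ¬ (ord x₁ f' < 0 ∧ ord x₂ f' < 0))
    (hex : ∃ f ∈ N.Minfκ, (∀ g : N.piRat, g • f = f) ∧
      ∃ x₁ x₂ : X, x₁ ≠ x₂ ∧ 0 < ord x₁ f ∧ 0 < ord x₂ f) :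
    ExistsUniqueCoricStructure N.piRat N.infκPair :=
  N.existsUniqueCoricStructure_infκPair_kummerMap S hS hcoe hprim hc h1 hpow hinj ord
    (fun u f f' hf hf' h x => N.kummerMap_hord_of_ordHom_of_subset N.Minfκ _ S hS
      (fun h0 => N.zero_notMem (N.minfκ_subset h0)) hcoe hc hfi ord hordmul u f f' hf hf' h x) hpole hex

include hS in
/-- **∞κ, modulo laws of the genuine Galois action only, NO inertia**: as `…_infκPair_of_ordHom` with the
injectivity replaced by (iv) `hdiv` (no `S i`-invariant unit other than `1` has `S i`-invariant roots of all
orders).  PROVED. ([IUTchI] Ex 5.1 (v) p.128) [claim: Mochizuki2012, status: disputed] -/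
theorem existsUniqueCoricStructure_infκPair_of_ordHom_of_fixedRoots
    (hcoe : ∀ (g : N.piRat) (a : N.Kratˣ), ((g • a : N.Kratˣ) : N.Krat) = g • (a : N.Krat))
    (hprim : ∀ n : ℕ, 0 < n → ∃ ζ : N.Krat, IsPrimitiveRoot ζ n) (hc : IsExhausted N.Kratˣ S)
    (hfi : ∀ i, (S i).FiniteIndex)
    (h1 : (1 : N.Krat) ∈ N.Minfκ) (hpow : ∀ (f : N.Krat) (n : ℕ), 0 < n → (f ∈ N.Minfκ ↔ f ^ n ∈ N.Minfκ))
    (hdiv : ∀ (i : ι) (a : N.Kratˣ), a ∈ invariants (A := N.Kratˣ) (S i) →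
      (∀ n : ℕ+, ∃ b ∈ invariants (A := N.Kratˣ) (S i), b ^ (n : ℕ) = a) → a = 1)
    {X : Type*} (ord : X → N.Krat → ℤ)
    (hordmul : ∀ (x : X) (a b : N.Krat), a ≠ 0 → b ≠ 0 → (∀ g : N.piRat, g • a = a) → (∀ g : N.piRat, g • b = b) →
      ord x (a * b) = ord x a + ord x b)
    (hpole : ∀ f' ∈ N.Minfκ, (∀ g : N.piRat, g • f' = f') →
      ∀ x₁ x₂ : X, x₁ ≠ x₂ → ¬ (ord x₁ f' < 0 ∧ ord x₂ f' < 0))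
    (hex : ∃ f ∈ N.Minfκ, (∀ g : N.piRat, g • f = f) ∧
      ∃ x₁ x₂ : X, x₁ ≠ x₂ ∧ 0 < ord x₁ f ∧ 0 < ord x₂ f) :
    ExistsUniqueCoricStructure N.piRat N.infκPair :=
  N.existsUniqueCoricStructure_infκPair_of_ordHom S hS hcoe hprim hc hfi h1 hpow
    (fun a b hab => Additive.ofMul.injective (kummerMapHom_injective_of S hS hc hdiv (a₁ := Additive.ofMul a)
      (a₂ := Additive.ofMul b) hab)) ord hordmul hpole hex

/-- **[IUTchI] Ex. 5.1 (v), "respectively, ∞κ×": `ExistsUniqueCoricStructure π₁^rat 𝕄^⊛_∞κ×(†𝒟^⊚)` at the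
GENUINE Kummer map with (b′) from the additivity of `ord_x` (o).**  PROVED. ([IUTchI] Ex 5.1 (v) p.128)
[claim: Mochizuki2012, status: disputed] -/
theorem existsUniqueCoricStructure_infκxPair_of_ordHom
    (hcoe : ∀ (g : N.piRat) (a : N.Kratˣ), ((g • a : N.Kratˣ) : N.Krat) = g • (a : N.Krat))
    (hprim : ∀ n : ℕ, 0 < n → ∃ ζ : N.Krat, IsPrimitiveRoot ζ n) (hc : IsExhausted N.Kratˣ S)
    (hfi : ∀ i, (S i).FiniteIndex)
    (h1 : (1 : N.Krat) ∈ N.Minfκx) (hpow : ∀ (f : N.Krat) (n : ℕ), 0 < n → (f ∈ N.Minfκx ↔ f ^ n ∈ N.Minfκx))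
    (hinj : Function.Injective (kummerMap hS hc))
    {X : Type*} (ord : X → N.Krat → ℤ)
    (hordmul : ∀ (x : X) (a b : N.Krat), a ≠ 0 → b ≠ 0 → (∀ g : N.piRat, g • a = a) → (∀ g : N.piRat, g • b = b) →
      ord x (a * b) = ord x a + ord x b)
    (hpole : ∀ f' ∈ N.Minfκx, (∀ g : N.piRat, g • f' = f') →
      ∀ x₁ x₂ : X, x₁ ≠ x₂ → ¬ (ord x₁ f' < 0 ∧ ord x₂ f' < 0))
    (hex : ∃ f ∈ N.Minfκx, (∀ g : N.piRat, g • f = f) ∧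
      ∃ x₁ x₂ : X, x₁ ≠ x₂ ∧ 0 < ord x₁ f ∧ 0 < ord x₂ f) :
    ExistsUniqueCoricStructure N.piRat N.infκxPair :=
  N.existsUniqueCoricStructure_infκxPair_kummerMap S hS hcoe hprim hc h1 hpow hinj ord
    (fun u f f' hf hf' h x => N.kummerMap_hord_of_ordHom_of_subset N.Minfκx _ S hS N.zero_notMem hcoe hc hfi ord
      hordmul u f f' hf hf' h x) hpole hex

include hS in
/-- **"Respectively, ∞κ×", modulo laws of the genuine Galois action only, NO inertia** ((iv) `hdiv` instead of the
injectivity).  PROVED. ([IUTchI] Ex 5.1 (v) p.128) [claim: Mochizuki2012, status: disputed] -/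
theorem existsUniqueCoricStructure_infκxPair_of_ordHom_of_fixedRoots
    (hcoe : ∀ (g : N.piRat) (a : N.Kratˣ), ((g • a : N.Kratˣ) : N.Krat) = g • (a : N.Krat))
    (hprim : ∀ n : ℕ, 0 < n → ∃ ζ : N.Krat, IsPrimitiveRoot ζ n) (hc : IsExhausted N.Kratˣ S)
    (hfi : ∀ i, (S i).FiniteIndex)
    (h1 : (1 : N.Krat) ∈ N.Minfκx) (hpow : ∀ (f : N.Krat) (n : ℕ), 0 < n → (f ∈ N.Minfκx ↔ f ^ n ∈ N.Minfκx))
    (hdiv : ∀ (i : ι) (a : N.Kratˣ), a ∈ invariants (A := N.Kratˣ) (S i) →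
      (∀ n : ℕ+, ∃ b ∈ invariants (A := N.Kratˣ) (S i), b ^ (n : ℕ) = a) → a = 1)
    {X : Type*} (ord : X → N.Krat → ℤ)
    (hordmul : ∀ (x : X) (a b : N.Krat), a ≠ 0 → b ≠ 0 → (∀ g : N.piRat, g • a = a) → (∀ g : N.piRat, g • b = b) →
      ord x (a * b) = ord x a + ord x b)
    (hpole : ∀ f' ∈ N.Minfκx, (∀ g : N.piRat, g • f' = f') →
      ∀ x₁ x₂ : X, x₁ ≠ x₂ → ¬ (ord x₁ f' < 0 ∧ ord x₂ f' < 0))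
    (hex : ∃ f ∈ N.Minfκx, (∀ g : N.piRat, g • f = f) ∧
      ∃ x₁ x₂ : X, x₁ ≠ x₂ ∧ 0 < ord x₁ f ∧ 0 < ord x₂ f) :
    ExistsUniqueCoricStructure N.piRat N.infκxPair :=
  N.existsUniqueCoricStructure_infκxPair_of_ordHom S hS hcoe hprim hc hfi h1 hpow
    (fun a b hab => Additive.ofMul.injective (kummerMapHom_injective_of S hS hc hdiv (a₁ := Additive.ofMul a)
      (a₂ := Additive.ofMul b) hab)) ord hordmul hpole hex

end NFBridgeRecon

end Literature.IUT.HodgeTheaters
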